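import Mathlib
import HarnessLib

set_option linter.dupNamespace false

/-!
# Lifting an extension with finite-length kernel along a base change

`[OURS · L w44b · completion model, ascent half · res-type-015 gen 15]` — second brick towards the
discharge of the named fact `Literature.RingTheory.CohomologyAnnihilator.le_caCompletion_comap`
([BahlekehHakimianSalarianTakahashi2015, Thm. 4.5 (2)]), helper for the surface rung
`PersistenceSurface` (stmt-ResolutionOfSingularities-19970) of crux chain w44b.  NOT a statement of
the manuscript under adjudication in cell res-hironaka; pure linear algebra over Mathlib.

The printed proof of [BHST15, Cor. 4.4] lifts extensions of completed modules along `R → R̂` via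
[Takahashi 2010, stcm] (an extension class in `Ext¹_R̂(N̂₂, N̂₁) = Ext¹_R(N₂, N₁)^` comes from `R`
when that `Ext` group has finite length).  We use the following `Ext`-free form, for an ARBITRARY
algebra `R → S`:

* `exists_linearEquiv_baseChange_of_extension` — let `0 → S ⊗_R A₀ —f→ B —g→ S ⊗_R N → 0` be an
  exact sequence of `S`-modules with `N`, `A₀` finitely generated over `R` and such that
  `a ↦ 1 ⊗ a : A₀ → S ⊗_R A₀` is BIJECTIVE (e.g. `A₀` of finite length and `S = R̂`).  Then
  `B ≅ S ⊗_R N'` for a finitely generated `R`-module `N'`.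

Proof: choose `0 → K → Rᵇ → N → 0`; lift `S ⊗ Rᵇ ↠ S ⊗ N` to `β : S ⊗ Rᵇ → B`; the induced
`γ : S ⊗ K → S ⊗ A₀` (`f γ = β ∘ (S ⊗ ι)`) is `S ⊗ h₀` for the `R`-linear `h₀ k = 1⁻¹(γ (1 ⊗ k))`
(this is where bijectivity of `A₀ → S ⊗ A₀` enters); then `B` is the quotient of
`S ⊗ (A₀ × Rᵇ)` by the image of `S ⊗ K` under `S ⊗ (h₀, -ι)`, i.e. `B ≅ S ⊗_R N'` with
`N' = (A₀ × Rᵇ)/(h₀, -ι)(K)` the push-out (right exactness of `S ⊗_R -`).  No flatness is needed.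

References: A. Bahlekeh, E. Hakimian, S. Salarian, R. Takahashi, arXiv:1504.06163, Cor. 4.4
[`BahlekehHakimianSalarianTakahashi2015`]; R. Takahashi, *Classifying thick subcategories of the
stable category of Cohen–Macaulay modules*, Adv. Math. 225 (2010) [stcm].
-/

noncomputable section

open scoped TensorProduct

universe u

namespace Summit.ResolutionOfSingularities.ResolutionOfSingularities.Theorems.HomologicalConductor.CompletionAscentLifting

variable {R S : Type u} [CommRing R] [CommRing S] [Algebra R S]

/-- Two `S`-linear maps out of `S ⊗_R M` agreeing on the elementary tensors `1 ⊗ m` are equal.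
[folklore] -/
theorem linearMap_ext_one_tmul {M : Type u} [AddCommGroup M] [Module R M] {P : Type u}
    [AddCommGroup P] [Module S P] {φ χ : S ⊗[R] M →ₗ[S] P}
    (h : ∀ m : M, φ ((1 : S) ⊗ₜ[R] m) = χ ((1 : S) ⊗ₜ[R] m)) : φ = χ := by
  refine LinearMap.ext fun x => ?_
  induction x using TensorProduct.induction_on with
  | zero => rw [map_zero, map_zero]
  | tmul s m =>
    have hs : s ⊗ₜ[R] m = s • ((1 : S) ⊗ₜ[R] m) := by
      rw [TensorProduct.smul_tmul', smul_eq_mul, mul_one]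
    rw [hs, map_smul, map_smul, h]
  | add x y hx hy => rw [map_add, map_add, hx, hy]

/-- `x = inl (fst x) + inr (snd x)` on `S ⊗_R (A × F)`, with the base-changed structure maps.
[folklore] -/
theorem baseChange_inl_fst_add_inr_snd {A F : Type u} [AddCommGroup A] [Module R A]
    [AddCommGroup F] [Module R F] (x : S ⊗[R] (A × F)) :
    (LinearMap.inl R A F).baseChange S ((LinearMap.fst R A F).baseChange S x) +
      (LinearMap.inr R A F).baseChange S ((LinearMap.snd R A F).baseChange S x) = x := by
  induction x using TensorProduct.induction_on with
  | zero => simp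
  | tmul s p =>
    obtain ⟨a, v⟩ := p
    simp only [LinearMap.baseChange_tmul, LinearMap.fst_apply, LinearMap.snd_apply,
      LinearMap.inl_apply, LinearMap.inr_apply, ← TensorProduct.tmul_add, Prod.mk_add_mk, add_zero,
      zero_add]
  | add x y hx hy =>
    rw [map_add, map_add, map_add, map_add, add_add_add_comm, hx, hy]

/-- **Lifting an extension with «finite-length» kernel along a base change.**  Let `R → S` be an
algebra, `A₀` and `N` finitely generated `R`-modules with `a ↦ 1 ⊗ a : A₀ → S ⊗_R A₀` bijective,
and `0 → S ⊗_R A₀ —f→ B —g→ S ⊗_R N → 0` an exact sequence of `S`-modules.  Then `B ≅ S ⊗_R N'`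
(`S`-linearly) for some finitely generated `R`-module `N'` (the push-out of a presentation
`K ↪ Rᵇ ↠ N` along the `R`-linear map `K → A₀` underlying the comparison map `S ⊗ K → S ⊗ A₀`).
[cite: BahlekehHakimianSalarianTakahashi2015, Corollary 4.4 (proof mechanism, via [stcm])] -/
theorem exists_linearEquiv_baseChange_of_extension
    {A₀ : Type u} [AddCommGroup A₀] [Module R A₀] [Module.Finite R A₀]
    (hA₀ : Function.Bijective (TensorProduct.mk R S A₀ 1))
    {N : Type u} [AddCommGroup N] [Module R N] [Module.Finite R N]
    {B : Type u} [AddCommGroup B] [Module S B]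
    (f : S ⊗[R] A₀ →ₗ[S] B) (g : B →ₗ[S] S ⊗[R] N)
    (hf : Function.Injective f) (hg : Function.Surjective g) (hfg : Function.Exact f g) :
    ∃ (N' : Type u) (_ : AddCommGroup N') (_ : Module R N') (_ : Module.Finite R N'),
      Nonempty (B ≃ₗ[S] S ⊗[R] N') := by
  classical
  -- a presentation `0 → K → Rᵇ → N → 0`
  obtain ⟨b, π₀, hπ₀⟩ := Module.Finite.exists_fin' R N
  let F := Fin b → R
  let K : Submodule R F := LinearMap.ker π₀
  let ιK : K →ₗ[R] F := K.subtype
  have hιπ : Function.Exact ιK π₀ := LinearMap.exact_subtype_ker_map π₀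
  -- base change of the presentation
  let πS : S ⊗[R] F →ₗ[S] S ⊗[R] N := π₀.baseChange S
  let ιS : S ⊗[R] K →ₗ[S] S ⊗[R] F := ιK.baseChange S
  have hιS : ∀ (s : S) (k : K), ιS (s ⊗ₜ[R] k) = s ⊗ₜ[R] (k : F) := fun s k =>
    LinearMap.baseChange_tmul _ _ _
  have hπS : Function.Surjective πS := by
    change Function.Surjective (π₀.baseChange S : S ⊗[R] F → S ⊗[R] N)
    rw [LinearMap.baseChange_eq_ltensor]
    exact LinearMap.lTensor_surjective S hπ₀
  have hιπS : Function.Exact ιS πS := by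
    change Function.Exact (ιK.baseChange S : S ⊗[R] K → S ⊗[R] F)
      (π₀.baseChange S : S ⊗[R] F → S ⊗[R] N)
    rw [LinearMap.baseChange_eq_ltensor, LinearMap.baseChange_eq_ltensor]
    exact lTensor_exact S hιπ hπ₀
  -- lift `πS` through `g`
  haveI : Module.Projective S (S ⊗[R] F) := Module.Projective.of_free
  obtain ⟨β, hβ⟩ := Module.projective_lifting_property g πS hg
  have hβ' : ∀ v, g (β v) = πS v := fun v => LinearMap.congr_fun hβ v
  -- the comparison map `γ : S ⊗ K → S ⊗ A₀`, `f ∘ γ = β ∘ ιS`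
  obtain ⟨γ, hγ⟩ : ∃ γ : S ⊗[R] K →ₗ[S] S ⊗[R] A₀, ∀ k, f (γ k) = β (ιS k) := by
    have hmem : ∀ k : S ⊗[R] K, β (ιS k) ∈ LinearMap.range f := fun k => by
      rw [← hfg.linearMap_ker_eq, LinearMap.mem_ker, hβ', hιπS.apply_apply_eq_zero]
    let eF := LinearEquiv.ofInjective f hf
    refine ⟨eF.symm.toLinearMap ∘ₗ LinearMap.codRestrict (LinearMap.range f) (β ∘ₗ ιS) hmem,
      fun k => ?_⟩
    have h := congrArg Subtype.val (eF.apply_symm_apply ⟨β (ιS k), hmem k⟩)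
    rw [LinearEquiv.ofInjective_apply] at h
    exact h
  -- descend `γ` to `R`: `γ (s ⊗ k) = s ⊗ h₀ k`
  obtain ⟨h₀, hh₀⟩ : ∃ h₀ : K →ₗ[R] A₀, ∀ (s : S) (k : K), γ (s ⊗ₜ[R] k) = s ⊗ₜ[R] h₀ k := by
    let eA : A₀ ≃ₗ[R] S ⊗[R] A₀ := LinearEquiv.ofBijective (TensorProduct.mk R S A₀ 1) hA₀
    have heA : ∀ a : A₀, eA a = (1 : S) ⊗ₜ[R] a := fun a => rfl
    let h₀ : K →ₗ[R] A₀ := eA.symm.toLinearMap ∘ₗ (γ.restrictScalars R ∘ₗ TensorProduct.mk R S K 1)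
    have hh₀ : ∀ k : K, (1 : S) ⊗ₜ[R] h₀ k = γ ((1 : S) ⊗ₜ[R] k) := fun k => by
      rw [← heA, show h₀ k = eA.symm (γ ((1 : S) ⊗ₜ[R] k)) from rfl, LinearEquiv.apply_symm_apply]
    have hγh₀ : γ = h₀.baseChange S :=
      linearMap_ext_one_tmul fun k => by rw [LinearMap.baseChange_tmul, hh₀]
    exact ⟨h₀, fun s k => by rw [hγh₀, LinearMap.baseChange_tmul]⟩
  -- the push-out `N' = (A₀ × Rᵇ) / (h₀, -ι)(K)`
  let δ : K →ₗ[R] A₀ × F := LinearMap.prod h₀ (-ιK)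
  have hδ : ∀ k : K, δ k = (h₀ k, -(k : F)) := fun k => rfl
  let N' := (A₀ × F) ⧸ LinearMap.range δ
  -- the structure maps of `S ⊗ (A₀ × Rᵇ)`
  let inlS : S ⊗[R] A₀ →ₗ[S] S ⊗[R] (A₀ × F) := (LinearMap.inl R A₀ F).baseChange S
  let inrS : S ⊗[R] F →ₗ[S] S ⊗[R] (A₀ × F) := (LinearMap.inr R A₀ F).baseChange S
  let fstS : S ⊗[R] (A₀ × F) →ₗ[S] S ⊗[R] A₀ := (LinearMap.fst R A₀ F).baseChange S
  let sndS : S ⊗[R] (A₀ × F) →ₗ[S] S ⊗[R] F := (LinearMap.snd R A₀ F).baseChange S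
  have hdec : ∀ x, inlS (fstS x) + inrS (sndS x) = x := baseChange_inl_fst_add_inr_snd
  have hfst_inl : ∀ a, fstS (inlS a) = a := fun a => by
    change ((LinearMap.fst R A₀ F).baseChange S ∘ₗ (LinearMap.inl R A₀ F).baseChange S) a = a
    rw [← LinearMap.baseChange_comp, LinearMap.fst_comp_inl, LinearMap.baseChange_id,
      LinearMap.id_apply]
  have hsnd_inl : ∀ a, sndS (inlS a) = 0 := fun a => by
    change ((LinearMap.snd R A₀ F).baseChange S ∘ₗ (LinearMap.inl R A₀ F).baseChange S) a = 0
    rw [← LinearMap.baseChange_comp, LinearMap.snd_comp_inl, LinearMap.baseChange_zero,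
      LinearMap.zero_apply]
  have hfst_inr : ∀ v, fstS (inrS v) = 0 := fun v => by
    change ((LinearMap.fst R A₀ F).baseChange S ∘ₗ (LinearMap.inr R A₀ F).baseChange S) v = 0
    rw [← LinearMap.baseChange_comp, LinearMap.fst_comp_inr, LinearMap.baseChange_zero,
      LinearMap.zero_apply]
  have hsnd_inr : ∀ v, sndS (inrS v) = v := fun v => by
    change ((LinearMap.snd R A₀ F).baseChange S ∘ₗ (LinearMap.inr R A₀ F).baseChange S) v = v
    rw [← LinearMap.baseChange_comp, LinearMap.snd_comp_inr, LinearMap.baseChange_id,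
      LinearMap.id_apply]
  -- `Θ : S ⊗ (A₀ × Rᵇ) → B`, `x ↦ f (fst x) + β (snd x)`
  let Θ : S ⊗[R] (A₀ × F) →ₗ[S] B := f ∘ₗ fstS + β ∘ₗ sndS
  have hΘ : ∀ x, Θ x = f (fstS x) + β (sndS x) := fun x => rfl
  have hΘinl : ∀ a, Θ (inlS a) = f a := fun a => by
    rw [hΘ, hfst_inl, hsnd_inl, map_zero, add_zero]
  have hΘinr : ∀ v, Θ (inrS v) = β v := fun v => by
    rw [hΘ, hfst_inr, hsnd_inr, map_zero, zero_add]
  -- `δS = S ⊗ δ = inl ∘ γ - inr ∘ ιS`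
  let δS : S ⊗[R] K →ₗ[S] S ⊗[R] (A₀ × F) := δ.baseChange S
  have hδS : ∀ k, δS k = inlS (γ k) - inrS (ιS k) := by
    intro k
    change δS k = (inlS ∘ₗ γ - inrS ∘ₗ ιS) k
    congr 1
    refine linearMap_ext_one_tmul fun k => ?_
    rw [LinearMap.sub_apply, LinearMap.comp_apply, LinearMap.comp_apply, hh₀, hιS]
    change (1 : S) ⊗ₜ[R] δ k = (1 : S) ⊗ₜ[R] (LinearMap.inl R A₀ F (h₀ k)) -
      (1 : S) ⊗ₜ[R] (LinearMap.inr R A₀ F (k : F))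
    rw [hδ, ← TensorProduct.tmul_sub, LinearMap.inl_apply, LinearMap.inr_apply, Prod.mk_sub_mk,
      sub_zero, zero_sub]
  have hΘsurj : Function.Surjective Θ := by
    intro x
    obtain ⟨v, hv⟩ := hπS (g x)
    have hx : g (x - β v) = 0 := by rw [map_sub, hβ', hv, sub_self]
    obtain ⟨a, ha⟩ := (hfg _).1 hx
    refine ⟨inlS a + inrS v, ?_⟩
    rw [map_add, hΘinl, hΘinr, ha, sub_add_cancel]
  have hΘker : LinearMap.ker Θ = LinearMap.range δS := by
    apply le_antisymm
    · intro x hx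
      rw [LinearMap.mem_ker, hΘ] at hx
      -- `g (β (snd x)) = 0`, so `snd x = ιS k`
      have hgv : πS (sndS x) = 0 := by
        rw [← hβ', show β (sndS x) = -f (fstS x) from eq_neg_of_add_eq_zero_right hx, map_neg,
          hfg.apply_apply_eq_zero, neg_zero]
      obtain ⟨k, hk⟩ := (hιπS _).1 hgv
      -- `f (fst x) = -β (ιS k) = -f (γ k)`, so `fst x = -γ k`
      have hfa : f (fstS x) = f (-γ k) := by
        rw [map_neg, hγ, hk]
        exact eq_neg_of_add_eq_zero_left hx
      have hak : fstS x = -γ k := hf hfa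
      refine ⟨-k, ?_⟩
      have hx' : x = inlS (-γ k) + inrS (ιS k) := by rw [← hak, hk, hdec]
      rw [hx', map_neg δS, hδS, map_neg inlS, neg_sub, sub_eq_neg_add]
    · rintro _ ⟨k, rfl⟩
      rw [LinearMap.mem_ker, hδS, map_sub, hΘinl, hΘinr, hγ, sub_self]
  -- `S ⊗ N' ≅ (S ⊗ (A₀ × Rᵇ)) / range δS` (right exactness) `≅ B`
  have hexact : Function.Exact δS ((LinearMap.range δ).mkQ.baseChange S) := by
    change Function.Exact (δ.baseChange S : S ⊗[R] K → S ⊗[R] (A₀ × F))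
      ((LinearMap.range δ).mkQ.baseChange S : S ⊗[R] (A₀ × F) → S ⊗[R] N')
    rw [LinearMap.baseChange_eq_ltensor, LinearMap.baseChange_eq_ltensor]
    exact lTensor_exact S (LinearMap.exact_map_mkQ_range δ) (Submodule.mkQ_surjective _)
  have hmkS : Function.Surjective ((LinearMap.range δ).mkQ.baseChange S) := by
    rw [LinearMap.baseChange_eq_ltensor]
    exact LinearMap.lTensor_surjective S (Submodule.mkQ_surjective _)
  let e₂ : ((S ⊗[R] (A₀ × F)) ⧸ LinearMap.range δS) ≃ₗ[S] S ⊗[R] N' :=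
    hexact.linearEquivOfSurjective hmkS
  let e₁ : ((S ⊗[R] (A₀ × F)) ⧸ LinearMap.ker Θ) ≃ₗ[S] B := Θ.quotKerEquivOfSurjective hΘsurj
  exact ⟨N', inferInstance, inferInstance, inferInstance,
    ⟨e₁.symm ≪≫ₗ Submodule.quotEquivOfEq _ _ hΘker ≪≫ₗ e₂⟩⟩

end Summit.ResolutionOfSingularities.ResolutionOfSingularities.Theorems.HomologicalConductor.CompletionAscentLifting

end
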